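import Summits.FinalStateConjecture.FinalStateConjecture.Theorems.PhotonSphereChannelsWindowedShellChannelsPerModeCore
import Summits.FinalStateConjecture.FinalStateConjecture.Theorems.PhotonSphereChannelsWindowedShellChannelsStubUnitMass
import Summits.FinalStateConjecture.FinalStateConjecture.Theorems.PhotonSphereChannelsWindowedShellChannelsStubRecentre
import Summits.FinalStateConjecture.FinalStateConjecture.Theorems.PhotonSphereChannelsWindowedShellChannelsStubFiniteEnergy

/-!
# Crux `WindowedShellChannels` (stmt-FinalStateConjecture-14085) — the PER-MODE windowed shell channels
# (`FixedModeWindowedChannels` of the crux dossier) as a theorem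

**Theorem (`windowedShellChannels_perMode`).**  For every `M > 0`, every shell half-width `ρ > 0` and
every mode `s ≤ 2`, `s ≤ ℓ` there are a lag `h = h(M, ρ, s, ℓ) ≥ 0` and `c = c(M, ρ, s, ℓ) > 0` such that
for every tortoise radius function (`IsTortoiseRadius M r x_c`) and every global `C²` Regge–Wheeler solution
`ψ` of that mode whose Cauchy data vanish on the closed shell `{|x − x_c| ≤ ρ}`:

  `c · E ≤ channelEnergy V x_c (ρ − h) ψ atTop + channelEnergy V x_c (ρ − h) ψ atBot`.

This is the crux `WindowedShellChannels` with `(h, c)` allowed to depend on the mode — the per-mode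
rung `Ideator3.FixedModeWindowedChannels` of the crux dossier (the crux itself asks for uniformity in
`(s, ℓ)`, which is the semiclassical photon-sphere residue `stub_coreHigh`).  Proof: the per-mode
residue `stub_coreMode σ` (file `…PerModeCore`, composition of the six landed pieces of line `Sketch`)
on the unit-mass centred tortoise line for parity-pure finite-energy data, then the four reductions of
the line with the mode fixed: unit mass → general mass by the scaling `(t, x) ↦ (Mt, Mx)`
(`WindowedShellChannelsStubs.UnitMass`), centre `0` → centre `x_c` by translation (`…Recentre`),
finite → arbitrary energy (infinite energy forces infinite channel energies,
`WindowedShellChannels.Negative.channelEnergy_eq_top_of_totalEnergy_eq_top`), and parity-pure → general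
data by the time-parity parallelogram law (`…Parity.channel_parity_split`, `totalEnergy_zero_split`).
No definitions. [new]
-/

noncomputable section

set_option linter.dupNamespace false

namespace Summit.FinalStateConjecture.FinalStateConjecture.Theorems.WindowedShellChannelsSketch

open Literature.Geometry.Lorentzian Literature.Geometry.Lorentzian.ReggeWheeler
open Summit.FinalStateConjecture.FinalStateConjecture.Theorems.WindowedShellChannelsStubs
open Filter Set MeasureTheory
open scoped ENNReal Topology

namespace PerMode

/-- Unit mass → general mass, one mode (scaling; proof of `stub_unitMass` with the mode fixed). -/
theorem unitMass (σ : ℝ) {s ℓ : ℕ}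
    (H : ∀ ρ : ℝ, 0 < ρ → ∃ h : ℝ, 0 ≤ h ∧ ∃ c : ℝ, 0 < c ∧ ∀ ψ : ℝ → ℝ → ℝ,
          IsRWSolution 1 s ℓ (tortoiseRadius one_pos 0) ψ → (∀ t x, ψ (-t) x = σ * ψ t x) →
          CauchyDataSupportedOn ψ {x : ℝ | ρ < |x|} →
          totalEnergy (linePotential 1 s ℓ (tortoiseRadius one_pos 0)) ψ 0 ≠ ⊤ →
            ENNReal.ofReal c * totalEnergy (linePotential 1 s ℓ (tortoiseRadius one_pos 0)) ψ 0 ≤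
              channelEnergy (linePotential 1 s ℓ (tortoiseRadius one_pos 0)) 0 (ρ - h) ψ atTop) :
    ∀ (M : ℝ) (hM : 0 < M), ∀ ρ : ℝ, 0 < ρ → ∃ h : ℝ, 0 ≤ h ∧ ∃ c : ℝ, 0 < c ∧ ∀ ψ : ℝ → ℝ → ℝ,
        IsRWSolution M s ℓ (tortoiseRadius hM 0) ψ → (∀ t x, ψ (-t) x = σ * ψ t x) →
        CauchyDataSupportedOn ψ {x : ℝ | ρ < |x|} →
        totalEnergy (linePotential M s ℓ (tortoiseRadius hM 0)) ψ 0 ≠ ⊤ →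
          ENNReal.ofReal c * totalEnergy (linePotential M s ℓ (tortoiseRadius hM 0)) ψ 0 ≤
            channelEnergy (linePotential M s ℓ (tortoiseRadius hM 0)) 0 (ρ - h) ψ atTop := by
  intro M hM ρ hρ
  obtain ⟨h₁, hh₁, c, hc, H'⟩ := H (ρ / M) (div_pos hρ hM)
  refine ⟨M * h₁, mul_nonneg hM.le hh₁, c, hc, fun ψ hψ hpar hsupp hE => ?_⟩
  have hV := UnitMass.linePotential_one_eq hM s ℓ
  have hsol : IsRWSolution 1 s ℓ (tortoiseRadius one_pos 0) (fun t y => ψ (M * t) (M * y)) := by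
    show IsSolution (linePotential 1 s ℓ (tortoiseRadius one_pos 0)) _
    rw [hV]
    exact UnitMass.isSolution_scale hψ M
  have hpar' : ∀ t y, ψ (M * -t) (M * y) = σ * ψ (M * t) (M * y) := fun t y => by
    rw [mul_neg]
    exact hpar (M * t) (M * y)
  have hE' : totalEnergy (linePotential 1 s ℓ (tortoiseRadius one_pos 0))
      (fun t y => ψ (M * t) (M * y)) 0 ≠ ⊤ := by
    rw [hV, UnitMass.totalEnergy_scale hM, mul_zero]
    exact ENNReal.mul_ne_top ENNReal.ofReal_ne_top hE
  have K := H' (fun t y => ψ (M * t) (M * y)) hsol hpar' (UnitMass.supported_scale hM hsupp) hE'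
  have ha : M * (ρ / M - h₁) = ρ - M * h₁ := by
    rw [mul_sub, mul_div_cancel₀ ρ hM.ne']
  rw [hV, UnitMass.totalEnergy_scale hM, mul_zero, UnitMass.channelEnergy_scale hM, ha,
    mul_left_comm] at K
  exact (ENNReal.mul_le_mul_iff_right (ENNReal.ofReal_pos.2 hM).ne' ENNReal.ofReal_ne_top).1 K

/-- Centre `0` → centre `x_c`, one mode (translation; proof of `stub_recentre` with the mode fixed). -/
theorem recentre (σ : ℝ) {s ℓ : ℕ}
    (H : ∀ (M : ℝ) (hM : 0 < M), ∀ ρ : ℝ, 0 < ρ → ∃ h : ℝ, 0 ≤ h ∧ ∃ c : ℝ, 0 < c ∧ ∀ ψ : ℝ → ℝ → ℝ,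
          IsRWSolution M s ℓ (tortoiseRadius hM 0) ψ → (∀ t x, ψ (-t) x = σ * ψ t x) →
          CauchyDataSupportedOn ψ {x : ℝ | ρ < |x|} →
          totalEnergy (linePotential M s ℓ (tortoiseRadius hM 0)) ψ 0 ≠ ⊤ →
            ENNReal.ofReal c * totalEnergy (linePotential M s ℓ (tortoiseRadius hM 0)) ψ 0 ≤
              channelEnergy (linePotential M s ℓ (tortoiseRadius hM 0)) 0 (ρ - h) ψ atTop) :
    ∀ M : ℝ, 0 < M → ∀ ρ : ℝ, 0 < ρ → ∃ h : ℝ, 0 ≤ h ∧ ∃ c : ℝ, 0 < c ∧ ∀ (r : ℝ → ℝ) (xc : ℝ),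
      IsTortoiseRadius M r xc → ∀ ψ : ℝ → ℝ → ℝ,
        IsRWSolution M s ℓ r ψ → (∀ t x, ψ (-t) x = σ * ψ t x) →
        CauchyDataSupportedOn ψ {x : ℝ | ρ < |x - xc|} →
        totalEnergy (linePotential M s ℓ r) ψ 0 ≠ ⊤ →
          ENNReal.ofReal c * totalEnergy (linePotential M s ℓ r) ψ 0 ≤
            channelEnergy (linePotential M s ℓ r) xc (ρ - h) ψ atTop := by
  intro M hM ρ hρ
  obtain ⟨h, hh, c, hc, H'⟩ := H M hM ρ hρ
  refine ⟨h, hh, c, hc, fun r xc hr ψ hψ hpar hsupp hE => ?_⟩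
  have hV := Recentre.linePotential_tortoiseRadius_zero_eq hr hM s ℓ
  have hsol : IsRWSolution M s ℓ (tortoiseRadius hM 0) (fun t y => ψ t (y + xc)) := by
    show IsSolution (linePotential M s ℓ (tortoiseRadius hM 0)) (fun t y => ψ t (y + xc))
    rw [hV]
    exact Recentre.isSolution_xshift hψ xc
  have hpar' : ∀ t y, (fun t y => ψ t (y + xc)) (-t) y = σ * (fun t y => ψ t (y + xc)) t y :=
    fun t y => hpar t (y + xc)
  have hE' : totalEnergy (linePotential M s ℓ (tortoiseRadius hM 0))
      (fun t y => ψ t (y + xc)) 0 ≠ ⊤ := by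
    rw [hV, Recentre.totalEnergy_xshift]
    exact hE
  have K := H' (fun t y => ψ t (y + xc)) hsol hpar' (Recentre.supported_xshift hsupp) hE'
  rw [hV, Recentre.totalEnergy_xshift, Recentre.channelEnergy_xshift, zero_add] at K
  exact K

/-- Finite → arbitrary energy, one mode (proof of `stub_finiteEnergy` with the mode fixed). -/
theorem finiteEnergy (σ : ℝ) {s ℓ : ℕ} (hsℓ : s ≤ ℓ)
    (H : ∀ M : ℝ, 0 < M → ∀ ρ : ℝ, 0 < ρ → ∃ h : ℝ, 0 ≤ h ∧ ∃ c : ℝ, 0 < c ∧ ∀ (r : ℝ → ℝ) (xc : ℝ),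
        IsTortoiseRadius M r xc → ∀ ψ : ℝ → ℝ → ℝ,
          IsRWSolution M s ℓ r ψ → (∀ t x, ψ (-t) x = σ * ψ t x) →
          CauchyDataSupportedOn ψ {x : ℝ | ρ < |x - xc|} →
          totalEnergy (linePotential M s ℓ r) ψ 0 ≠ ⊤ →
            ENNReal.ofReal c * totalEnergy (linePotential M s ℓ r) ψ 0 ≤
              channelEnergy (linePotential M s ℓ r) xc (ρ - h) ψ atTop) :
    ∀ M : ℝ, 0 < M → ∀ ρ : ℝ, 0 < ρ → ∃ h : ℝ, 0 ≤ h ∧ ∃ c : ℝ, 0 < c ∧ ∀ (r : ℝ → ℝ) (xc : ℝ),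
      IsTortoiseRadius M r xc → ∀ ψ : ℝ → ℝ → ℝ,
        IsRWSolution M s ℓ r ψ → (∀ t x, ψ (-t) x = σ * ψ t x) →
        CauchyDataSupportedOn ψ {x : ℝ | ρ < |x - xc|} →
          ENNReal.ofReal c * totalEnergy (linePotential M s ℓ r) ψ 0 ≤
            channelEnergy (linePotential M s ℓ r) xc (ρ - h) ψ atTop := by
  intro M hM ρ hρ
  obtain ⟨h, hh, c, hc, H'⟩ := H M hM ρ hρ
  refine ⟨h, hh, c, hc, ?_⟩
  intro r xc hr ψ hψ hpar hsupp
  by_cases hE : totalEnergy (linePotential M s ℓ r) ψ 0 = ⊤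
  · obtain ⟨h1, -⟩ :=
      WindowedShellChannels.Negative.channelEnergy_eq_top_of_totalEnergy_eq_top
        (RW.differentiable_linePotential hr s ℓ) (fun x => (RW.linePotential_pos hr hsℓ x).le)
        hψ xc (ρ - h) hE
    rw [h1]
    exact le_top
  · exact H' r xc hr ψ hψ hpar hsupp hE

/-- The one-ended forward windowed inequality for parity-`σ` data of ONE mode, all masses, centres
and energies (chain `stub_coreMode` → unit mass → recentre → finite energy). -/
theorem oneEnded (σ : ℝ) {s ℓ : ℕ} (hs : s ≤ 2) (hsℓ : s ≤ ℓ) :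
    ∀ M : ℝ, 0 < M → ∀ ρ : ℝ, 0 < ρ → ∃ h : ℝ, 0 ≤ h ∧ ∃ c : ℝ, 0 < c ∧ ∀ (r : ℝ → ℝ) (xc : ℝ),
      IsTortoiseRadius M r xc → ∀ ψ : ℝ → ℝ → ℝ,
        IsRWSolution M s ℓ r ψ → (∀ t x, ψ (-t) x = σ * ψ t x) →
        CauchyDataSupportedOn ψ {x : ℝ | ρ < |x - xc|} →
          ENNReal.ofReal c * totalEnergy (linePotential M s ℓ r) ψ 0 ≤
            channelEnergy (linePotential M s ℓ r) xc (ρ - h) ψ atTop :=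
  finiteEnergy σ hsℓ (recentre σ (unitMass σ fun ρ hρ => stub_coreMode σ ρ hρ s ℓ hs hsℓ))

end PerMode

/-- **The per-mode windowed shell channels** (`FixedModeWindowedChannels` of the crux dossier of
`WindowedShellChannels`, stmt-FinalStateConjecture-14085): the crux with lag and constant allowed to
depend on the mode `(s, ℓ)`.  See the module docstring. [new] -/
theorem windowedShellChannels_perMode : ∀ M : ℝ, 0 < M → ∀ ρ : ℝ, 0 < ρ → ∀ (s ℓ : ℕ), s ≤ 2 → s ≤ ℓ → ∃ h : ℝ, 0 ≤ h ∧ ∃ c : ℝ, 0 < c ∧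
    ∀ (r : ℝ → ℝ) (xc : ℝ), IsTortoiseRadius M r xc → ∀ ψ : ℝ → ℝ → ℝ,
      IsRWSolution M s ℓ r ψ → CauchyDataSupportedOn ψ {x : ℝ | ρ < |x - xc|} →
        ENNReal.ofReal c * totalEnergy (linePotential M s ℓ r) ψ 0 ≤
          channelEnergy (linePotential M s ℓ r) xc (ρ - h) ψ atTop +
            channelEnergy (linePotential M s ℓ r) xc (ρ - h) ψ atBot := by
  intro M hM ρ hρ s ℓ hs hsℓ
  obtain ⟨h₁, hh₁, c₁, hc₁, H₁⟩ := PerMode.oneEnded 1 hs hsℓ M hM ρ hρ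
  obtain ⟨h₂, hh₂, c₂, hc₂, H₂⟩ := PerMode.oneEnded (-1) hs hsℓ M hM ρ hρ
  refine ⟨max h₁ h₂, le_trans hh₁ (le_max_left _ _), 2 * min c₁ c₂, by positivity, ?_⟩
  intro r xc hr ψ hψ hsupp
  have hV : Differentiable ℝ (linePotential M s ℓ r) := RW.differentiable_linePotential hr s ℓ
  have hV0 : ∀ x, 0 ≤ linePotential M s ℓ r x := fun x => (RW.linePotential_pos hr hsℓ x).le
  have heven : ∀ t x, 2⁻¹ * ψ (-t) x + 2⁻¹ * ψ (- -t) x = 1 * (2⁻¹ * ψ t x + 2⁻¹ * ψ (-t) x) := by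
    intro t x; rw [neg_neg, one_mul, add_comm]
  have hodd : ∀ t x,
      2⁻¹ * ψ (-t) x + -2⁻¹ * ψ (- -t) x = (-1) * (2⁻¹ * ψ t x + -2⁻¹ * ψ (-t) x) := by
    intro t x; rw [neg_neg]; ring
  have K₁ := (H₁ r xc hr _ (Parity.isSolution_comb hψ 2⁻¹ 2⁻¹) heven
    (Parity.supported_comb hψ.1 hsupp _ _)).trans (Parity.channelEnergy_mono_aperture _ xc
      (show ρ - max h₁ h₂ ≤ ρ - h₁ by linarith [le_max_left h₁ h₂]) _ atTop)
  have K₂ := (H₂ r xc hr _ (Parity.isSolution_comb hψ 2⁻¹ (-2⁻¹)) hodd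
    (Parity.supported_comb hψ.1 hsupp _ _)).trans (Parity.channelEnergy_mono_aperture _ xc
      (show ρ - max h₁ h₂ ≤ ρ - h₂ by linarith [le_max_right h₁ h₂]) _ atTop)
  have hc1 : ENNReal.ofReal (min c₁ c₂) ≤ ENNReal.ofReal c₁ :=
    ENNReal.ofReal_le_ofReal (min_le_left _ _)
  have hc2 : ENNReal.ofReal (min c₁ c₂) ≤ ENNReal.ofReal c₂ :=
    ENNReal.ofReal_le_ofReal (min_le_right _ _)
  rw [Parity.channel_parity_split hV hV0 hψ xc (ρ - max h₁ h₂),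
    Parity.totalEnergy_zero_split hV.continuous hV0 hψ.1, ENNReal.ofReal_mul zero_le_two,
    ENNReal.ofReal_ofNat, mul_add, mul_assoc, mul_assoc]
  exact add_le_add (mul_le_mul_right ((mul_le_mul_left hc1 _).trans K₁) 2)
    (mul_le_mul_right ((mul_le_mul_left hc2 _).trans K₂) 2)

end Summit.FinalStateConjecture.FinalStateConjecture.Theorems.WindowedShellChannelsSketch

end
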